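import Summits.Ventures.CertifiedManyBodySolver.Downfold.BoxesLa214V115M2c
import Summits.Ventures.CertifiedManyBodySolver.Observables.StiffnessApexTransportCurtainDoped
import HarnessLib

/-!
# M2(c) «LSCO x = 1/8» closers from the DOPED CURTAIN (`boxLa214E_M15v115` = `[−3/10, −1/5] × [29/5, 74/5] × [171/200, 179/200]`):
# one station `29/5`, the overhang asked for the CORNER objective `−X₀(−3/10)`, lever `1/10` instead of `27/148`

Venture CertifiedManyBodySolver, cell `pub/hubbard-downfold` (MO-S1 ↔ S2 seam, D-0150 line L-DF2 «box ↦ one word»); namespace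
`Summit.Ventures.CertifiedManyBodySolver.Downfold`; seat hubbard-downfold-unc-2 (`prover-hubbard-downfold-unc-2-g15-0`). Companion of
`Downfold/BoxesLa214V115M2c.lean` (the M2(c) domain and its one-station doped closers with lever `27/148`) on the doped curtain of
`Observables/StiffnessApexTransportCurtainDoped.lean`: the station's inner bundle `[−3/10, −1/5] × {29/5}` keeps its own-slot objectives; the
overhang bundle `[−357/740, −3/10] × {29/5}` carries the FIXED corner objective `−X₀(−3/10)`; then EVERY `K₂` lever is at most `q − p = 1/10`
(`la214E_M2c_curtain_lever`), so the «min K₂diag» price at `B = −1/5` [EST] is `1/100` (was `27/1480 ≈ 0.018`) and the `K₂`-free kinematic price is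
`< 0.0810570` (was `< 0.1478742`).

* `la214E_M2c_curtain_lever` — the arithmetic;
* `boxLa214E_M15v115_stiffnessWord_of_apexStation29o5_curtain_doped` — for every density `x ∈ [171/200, 179/200]`: inner own-slot family `valI x`
  with floor `BI x ≤ K₂`, overhang corner-objective family `valO x` with floor `BO x ≤ K₂` (both `≤ 0`), prices `−val + (1/10)(−B)/2 ≤ c` ⇒ the
  stiffness word `c` on `boxLa214E_M15v115`;
* `boxLa214E_M15v115_stiffnessWord_of_apexStation29o5_curtain_kinematic_doped` — NO `K₂` input: `−val + 0.0810570 ≤ c` on both families.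

Everything here is PROVED; no `sorry`, no definition. HONEST FRAMING: one-sided stiffness CEILINGS conditional BY NAME on the bundles plugged in
(CONTROL/CALIBRATION class + labelled Mott-proximity HEURISTIC); typing certifies nothing about La₁.₈₇₅Sr₀.₁₂₅CuO₄; a ceiling never speaks to the
presence of order; no `T_c`, no superconductivity verdict, no phase sentence; `B ≈ −0.2` is an EXPECTATION [EST], the prices are arithmetic.
-/

noncomputable section

namespace Summit.Ventures.CertifiedManyBodySolver.Downfold

open Set NonemptyInterval Filter
open Summit.Ventures.CertifiedManyBodySolver.Observables
open Summit.Ventures.CertifiedManyBodySolver.Certificates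
open Literature.MathematicalPhysics.QuantumLattice Literature.MathematicalPhysics.QuantumLattice.ThermodynamicLimit
open Literature.Probability.LatticeModels
open Matrix HubbardWave0

/-- The M2(c) CURTAIN arithmetic: overhang end `(−3/10)(2 − (29/5)/(74/5)) = −357/740` (unchanged); lever `q − p = −1/5 − (−3/10) = 1/10`;
`K₂`-free price `0.8105695·(1/10) < 0.0810570`; «min K₂diag» price at `B = −1/5` [EST]: `(1/10)(1/5)/2 = 1/100`. [folklore] -/
theorem la214E_M2c_curtain_lever :
    (-3 / 10 : ℝ) * (2 - 29 / 5 / (74 / 5)) = -(357 / 740) ∧ (-1 / 5 : ℝ) - -3 / 10 = 1 / 10 ∧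
      (0.8105695 : ℝ) * (1 / 10) < 0.0810570 ∧ (1 / 10 : ℝ) * (1 / 5) / 2 = 1 / 100 := by
  refine ⟨?_, ?_, ?_, ?_⟩ <;> norm_num

/-- **M2(c) CLOSER — ONE STATION, CURTAIN, doped.** Station `U_A = 29/5`; for every density `x ∈ [171/200, 179/200]`: an unconditional
own-slot f-sum orbit-lower family `valI x` on the INNER segment `s ∈ [−3/10, −1/5]` with a floor `BI x ≤ K₂` on the same classes, and an
orbit-lower family `valO x` for the FIXED corner objective `−X₀(−3/10)` on the OVERHANG `s ∈ [−357/740, −3/10]` with a floor `BO x ≤ K₂`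
(`BI x, BO x ≤ 0`), priced `−valI x s + (1/10)(−BI x)/2 ≤ c`, `−valO x s + (1/10)(−BO x)/2 ≤ c`: then the stiffness word `c` holds on
`boxLa214E_M15v115`. [cite: KomaTasaki1994, §1] [cite: ScalapinoWhiteZhang1993, §II] -/
theorem boxLa214E_M15v115_stiffnessWord_of_apexStation29o5_curtain_doped (valI valO : ℝ → ℝ → ℝ) (BI BO : ℝ → ℝ)
    (hBI0 : ∀ x ∈ Set.Icc (171 / 200 : ℝ) (179 / 200), BI x ≤ 0) (hBO0 : ∀ x ∈ Set.Icc (171 / 200 : ℝ) (179 / 200), BO x ≤ 0) (c : ℚ)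
    (hI : ∀ x ∈ Set.Icc (171 / 200 : ℝ) (179 / 200), ∀ s ∈ Set.Icc (-3 / 10 : ℝ) (-1 / 5),
      ∀ (ω : InfVolFermionState 2) (Ls : ℕ → ℕ) (ψ : ∀ L, Fock (Orb (FermionTorus 2 L))),
      Tendsto Ls atTop atTop →
      (∀ j, IsGroundStateInSector (hubbardTorusTT' (Ls j) 1 s (29 / 5)) (rectN x (Ls j)) 0 (ψ (Ls j))) →
      (∀ j, star (ψ (Ls j)) ⬝ᵥ ψ (Ls j) = 1) → ω.IsTorusLimitOf ψ Ls →
      valI x s ≤ ((Finset.univ : Finset (DihedralGroup 4)).card : ℝ)⁻¹ * ∑ g ∈ (Finset.univ : Finset (DihedralGroup 4)),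
        (ω.expect (d4ShiftSet g 0 (Literature.Probability.LatticeModels.box 2 7))
          (fermionEmbed (PolySite.d4Emb g 0 (Literature.Probability.LatticeModels.box 2 7)) (-oddMomentObsTT s (29 / 5) 0))).re)
    (hKI : ∀ x ∈ Set.Icc (171 / 200 : ℝ) (179 / 200), ∀ s ∈ Set.Icc (-3 / 10 : ℝ) (-1 / 5),
      ∀ (ω : InfVolFermionState 2) (Ls : ℕ → ℕ) (ψ : ∀ L, Fock (Orb (FermionTorus 2 L))),
      Tendsto Ls atTop atTop →
      (∀ j, IsGroundStateInSector (hubbardTorusTT' (Ls j) 1 s (29 / 5)) (rectN x (Ls j)) 0 (ψ (Ls j))) →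
      (∀ j, star (ψ (Ls j)) ⬝ᵥ ψ (Ls j) = 1) → ω.IsTorusLimitOf ψ Ls →
      BI x ≤ ω.meanEnergy (hubbardTTPrimeFermionInteraction 0 1 0) 1)
    (hcI : ∀ x ∈ Set.Icc (171 / 200 : ℝ) (179 / 200), ∀ s ∈ Set.Icc (-3 / 10 : ℝ) (-1 / 5),
      -valI x s + (1 / 10) * (-BI x) / 2 ≤ ((c : ℚ) : ℝ))
    (hO : ∀ x ∈ Set.Icc (171 / 200 : ℝ) (179 / 200), ∀ s ∈ Set.Icc (-(357 / 740) : ℝ) (-3 / 10),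
      ∀ (ω : InfVolFermionState 2) (Ls : ℕ → ℕ) (ψ : ∀ L, Fock (Orb (FermionTorus 2 L))),
      Tendsto Ls atTop atTop →
      (∀ j, IsGroundStateInSector (hubbardTorusTT' (Ls j) 1 s (29 / 5)) (rectN x (Ls j)) 0 (ψ (Ls j))) →
      (∀ j, star (ψ (Ls j)) ⬝ᵥ ψ (Ls j) = 1) → ω.IsTorusLimitOf ψ Ls →
      valO x s ≤ ((Finset.univ : Finset (DihedralGroup 4)).card : ℝ)⁻¹ * ∑ g ∈ (Finset.univ : Finset (DihedralGroup 4)),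
        (ω.expect (d4ShiftSet g 0 (Literature.Probability.LatticeModels.box 2 7))
          (fermionEmbed (PolySite.d4Emb g 0 (Literature.Probability.LatticeModels.box 2 7)) (-oddMomentObsTT (-3 / 10) (29 / 5) 0))).re)
    (hKO : ∀ x ∈ Set.Icc (171 / 200 : ℝ) (179 / 200), ∀ s ∈ Set.Icc (-(357 / 740) : ℝ) (-3 / 10),
      ∀ (ω : InfVolFermionState 2) (Ls : ℕ → ℕ) (ψ : ∀ L, Fock (Orb (FermionTorus 2 L))),
      Tendsto Ls atTop atTop →
      (∀ j, IsGroundStateInSector (hubbardTorusTT' (Ls j) 1 s (29 / 5)) (rectN x (Ls j)) 0 (ψ (Ls j))) →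
      (∀ j, star (ψ (Ls j)) ⬝ᵥ ψ (Ls j) = 1) → ω.IsTorusLimitOf ψ Ls →
      BO x ≤ ω.meanEnergy (hubbardTTPrimeFermionInteraction 0 1 0) 1)
    (hcO : ∀ x ∈ Set.Icc (171 / 200 : ℝ) (179 / 200), ∀ s ∈ Set.Icc (-(357 / 740) : ℝ) (-3 / 10),
      -valO x s + (1 / 10) * (-BO x) / 2 ≤ ((c : ℚ) : ℝ)) :
    HoldsOn (fun p : OneBandCoord → ℝ => ObsStiffnessSeqCeilingAt (p .tpOverT) (p .UOverT) (p .filling) c)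
      boxLa214E_M15v115 := by
  obtain ⟨eseg, elev, -, -⟩ := la214E_M2c_curtain_lever
  refine boxLa214E_M15v115_stiffnessWord_of_cellLeaf ?_
  have hbox := ObsStiffnessSeqCeilingAt_on_box3_of_apexStation_inner_and_cornerObjectiveOverhang_of_le_diagHop (p := -3 / 10)
    (q := -1 / 5) (UA := 29 / 5) (Umax := 74 / 5) (n₁ := 171 / 200) (n₂ := 179 / 200) (ℓ := 1 / 10) (by norm_num) (by norm_num)
    (by norm_num) (by norm_num) (by norm_num) (by norm_num) valI valO BI BO hBI0 hBO0 (Or.inl (by norm_num)) c hI hKI hcI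
    (by rw [eseg]; exact hO) (by rw [eseg]; exact hKO) (by rw [eseg]; exact hcO)
  intro tp htp U hU n hn
  exact hbox tp htp U hU n hn

/-- **M2(c) CURTAIN CLOSER, KINEMATIC edition (no `K₂` input).** The inner own-slot family and the overhang corner-objective family alone, with
`−valI x s + 0.0810570 ≤ c` and `−valO x s + 0.0810570 ≤ c`, give the word `c` on `boxLa214E_M15v115` (`|K₂| ≤ 1.6211390` on every class prices the
lever `1/10` by `< 0.0810570` — versus `< 0.1478742` for the companion's own-slot station). [cite: LiebLoss1993, §8, Theorem 8.2] [cite: ScalapinoWhiteZhang1993, §II] -/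
theorem boxLa214E_M15v115_stiffnessWord_of_apexStation29o5_curtain_kinematic_doped (valI valO : ℝ → ℝ → ℝ) (c : ℚ)
    (hI : ∀ x ∈ Set.Icc (171 / 200 : ℝ) (179 / 200), ∀ s ∈ Set.Icc (-3 / 10 : ℝ) (-1 / 5),
      ∀ (ω : InfVolFermionState 2) (Ls : ℕ → ℕ) (ψ : ∀ L, Fock (Orb (FermionTorus 2 L))),
      Tendsto Ls atTop atTop →
      (∀ j, IsGroundStateInSector (hubbardTorusTT' (Ls j) 1 s (29 / 5)) (rectN x (Ls j)) 0 (ψ (Ls j))) →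
      (∀ j, star (ψ (Ls j)) ⬝ᵥ ψ (Ls j) = 1) → ω.IsTorusLimitOf ψ Ls →
      valI x s ≤ ((Finset.univ : Finset (DihedralGroup 4)).card : ℝ)⁻¹ * ∑ g ∈ (Finset.univ : Finset (DihedralGroup 4)),
        (ω.expect (d4ShiftSet g 0 (Literature.Probability.LatticeModels.box 2 7))
          (fermionEmbed (PolySite.d4Emb g 0 (Literature.Probability.LatticeModels.box 2 7)) (-oddMomentObsTT s (29 / 5) 0))).re)
    (hcI : ∀ x ∈ Set.Icc (171 / 200 : ℝ) (179 / 200), ∀ s ∈ Set.Icc (-3 / 10 : ℝ) (-1 / 5),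
      -valI x s + 0.0810570 ≤ ((c : ℚ) : ℝ))
    (hO : ∀ x ∈ Set.Icc (171 / 200 : ℝ) (179 / 200), ∀ s ∈ Set.Icc (-(357 / 740) : ℝ) (-3 / 10),
      ∀ (ω : InfVolFermionState 2) (Ls : ℕ → ℕ) (ψ : ∀ L, Fock (Orb (FermionTorus 2 L))),
      Tendsto Ls atTop atTop →
      (∀ j, IsGroundStateInSector (hubbardTorusTT' (Ls j) 1 s (29 / 5)) (rectN x (Ls j)) 0 (ψ (Ls j))) →
      (∀ j, star (ψ (Ls j)) ⬝ᵥ ψ (Ls j) = 1) → ω.IsTorusLimitOf ψ Ls →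
      valO x s ≤ ((Finset.univ : Finset (DihedralGroup 4)).card : ℝ)⁻¹ * ∑ g ∈ (Finset.univ : Finset (DihedralGroup 4)),
        (ω.expect (d4ShiftSet g 0 (Literature.Probability.LatticeModels.box 2 7))
          (fermionEmbed (PolySite.d4Emb g 0 (Literature.Probability.LatticeModels.box 2 7)) (-oddMomentObsTT (-3 / 10) (29 / 5) 0))).re)
    (hcO : ∀ x ∈ Set.Icc (171 / 200 : ℝ) (179 / 200), ∀ s ∈ Set.Icc (-(357 / 740) : ℝ) (-3 / 10),
      -valO x s + 0.0810570 ≤ ((c : ℚ) : ℝ)) :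
    HoldsOn (fun p : OneBandCoord → ℝ => ObsStiffnessSeqCeilingAt (p .tpOverT) (p .UOverT) (p .filling) c)
      boxLa214E_M15v115 := by
  -- the kinematic `K₂` floor `−1.6211390 ≤ K₂` on every torus-limit ground-state class of density in `[0, 2)`
  have hK : ∀ (t' U' x : ℝ), x ∈ Set.Icc (171 / 200 : ℝ) (179 / 200) →
      ∀ (ω : InfVolFermionState 2) (Ls : ℕ → ℕ) (ψ : ∀ L, Fock (Orb (FermionTorus 2 L))),
      Tendsto Ls atTop atTop →
      (∀ j, IsGroundStateInSector (hubbardTorusTT' (Ls j) 1 t' U') (rectN x (Ls j)) 0 (ψ (Ls j))) →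
      (∀ j, star (ψ (Ls j)) ⬝ᵥ ψ (Ls j) = 1) → ω.IsTorusLimitOf ψ Ls →
      -(1.6211390 : ℝ) ≤ ω.meanEnergy (hubbardTTPrimeFermionInteraction 0 1 0) 1 := by
    intro t' U' x hx ω Ls ψ hLs hψ h1 hω
    have hN : ∀ j, IsNParticle (rectN x (Ls j)) (ψ (Ls j)) := fun j => ((mem_szSector_iff _ _ _).1 (hψ j).1).1
    exact (abs_le.1 (hω.abs_meanEnergy_diagHop_le_decimal (by linarith [hx.1]) (by linarith [hx.2]) hLs hN h1)).1
  refine boxLa214E_M15v115_stiffnessWord_of_apexStation29o5_curtain_doped valI valO (fun _ => -(1.6211390 : ℝ))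
    (fun _ => -(1.6211390 : ℝ)) (fun _ _ => by norm_num) (fun _ _ => by norm_num) c hI
    (fun x hx s _ ω Ls ψ hLs hψ h1 hω => hK s (29 / 5) x hx ω Ls ψ hLs hψ h1 hω) (fun x hx s hs => ?_) hO
    (fun x hx s _ ω Ls ψ hLs hψ h1 hω => hK s (29 / 5) x hx ω Ls ψ hLs hψ h1 hω) (fun x hx s hs => ?_)
  · have h := hcI x hx s hs
    have e : (1 / 10 : ℝ) * (-(-(1.6211390 : ℝ))) / 2 = 0.8105695 * (1 / 10) := by norm_num
    obtain ⟨-, -, hlt, -⟩ := la214E_M2c_curtain_lever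
    linarith
  · have h := hcO x hx s hs
    have e : (1 / 10 : ℝ) * (-(-(1.6211390 : ℝ))) / 2 = 0.8105695 * (1 / 10) := by norm_num
    obtain ⟨-, -, hlt, -⟩ := la214E_M2c_curtain_lever
    linarith

end Summit.Ventures.CertifiedManyBodySolver.Downfold

end
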